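import Summits.QuantumFields.YangMills.Theorems.BalabanUVNodesN06CutLettersPinsPrintAtRecord
import Literature.MathematicalPhysics.QuantumFieldTheory.Balaban1983to89.B9Thm313WholeGXHRegular
import Literature.MathematicalPhysics.QuantumFieldTheory.Balaban1983to89.B9RWSums347DefiniteFaces
import Literature.MathematicalPhysics.QuantumFieldTheory.Balaban1983to89.B9RowSum261DefiniteFaces
import Literature.MathematicalPhysics.QuantumFieldTheory.Balaban1983to89.B9PerturbationMajorantsAtLettersPhys
import Literature.MathematicalPhysics.QuantumFieldTheory.Balaban1983to89.B9GradViaDivLettersTransported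
import Literature.MathematicalPhysics.QuantumFieldTheory.Balaban1983to89.B9BackgroundsKLevelV1R
import Literature.MathematicalPhysics.QuantumFieldTheory.Balaban1983to89.B9GeoLemma21KLevelV1
import Literature.MathematicalPhysics.QuantumFieldTheory.Balaban1983to89.B9PinMembersKLevelV1
import Literature.MathematicalPhysics.QuantumFieldTheory.Balaban1983to89.B9LettersHZAtOne
import Literature.MathematicalPhysics.QuantumFieldTheory.Balaban1983to89.B9CoReadingCoordsHolderAdm

/-!
# BalabanUVNodes ∕ N06 ([B9], `Dag.B9_main`) — ROWS 20–21's RE-CUT RECORD `hletters13 : Letters313Zc … (bXH x U) U` DERIVED AT THE PRINT-WEIGHTED BOND PIN (P1′) WITH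
# `gXH` (G₁∇\*_U : 𝔠_Y⁽⁰⁾ → bXH) FROM THE REGULAR STATE 𝔖₁ = bXH — NO STEP ON A RAW SUP CLASS: the twin of `…N06Letters13LegAtPinsPhysPU.hletters13_of_pinsP8_geo9Y`
# (dag-n06-d g16) whose `gXH` branch read the raw-class step `G₀(Δ′_π+Δ⁽²⁾_π) : 𝔠⁽¹⁾ → 𝔠⁽¹⁾` + its raw Hölder probe (the certificate's `hG0P`.1 ∕ .2.2.2; LOCATED-U8″)

Track A of `YM-PLAN.md` (cell `pub-ymgap`, HUMAN RULING D-0062), node **N06** = [Balaban1985BackgroundPropagators] Thms 3.1–3.15; seat `pub-ymgap-dag-n06-l` (gen 29)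
for the `pub-ymgap-dag-n06-d` knit (KNIT NOTE (K1), bus 2026-08-29).  WHY.  Director-ym №289 (1): «U8 cured» = NO raw-class `Step … 1∕2` letter anywhere in the certificate's
cone.  The certificate of record (ED.73∕74∕75) derives `hletters13` through `hletters13_of_pinsP8_geo9Y`, whose field `gXH` comes from dag-n06-l g24
`B9Thm313WholeCutLettersGXHAtPinsP.gXH_bHZKPG_of_pins` = the Neumann series Σ(G₀T)ⁿG₀∇\*_U summed ON THE RAW CLASS 𝔠⁽¹⁾ (hypotheses `hK`, `hpX` = the displayed
`hG0P` conjuncts (1)∕(4)).  THIS TWIN keeps every other input VERBATIM (the eight bXH-free letters `hZ8`, the print-literal (3.44) member `h44` for G′ with `h31 h49` and the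
closed budget `hB₃w` for `wGp := B9Thm313WholeCutLettersAtPinsP.wGp_bHZKPG_of_pins`, the pins `hbXH hblk12 hblkW12 hDvco12 hDvsco12 hRco12`, member facts `Facts347 ∕ RowSum`
DISCHARGED) and takes `gXH` from dag-n06-l g29's ★★ `B9Thm313WholeGXHRegular.gXH_of_stateS_two` (p724583): inputs = the STATE LAYER's own conjuncts at 𝔖₁ := `bXH x U` —
`hS` (the (3.130)∕(3.138) step `StepS (𝔬12 x) (bXH x U) (θS·(Mα₀)) δK U`), `hPDs` (Theorem 3.3's producer `G₀∇\*_U : 𝔠_Y^{(0)} → bXH`, constant `AD`, rate `δPs`), `hdomS`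
(the ℓ¹-domination `∃ Λ, bXH.loc y F ≤ Λ·Σ|F|`) = conjuncts 1, 5 and 11 of the row-21 S-leaf's `hstate1` as assembled by `…N06StateLayerAtPinsPU.hStateTuples_of_pinsP_geo9Y`
(`hst11`), the member-wise `Identities (𝔬12 x) U` (unchanged), the cutting cost `hκXle : (bXH x U).κ ≤ κX`, ONE numeric window `hqX : κX·(θS·a₀)·rowConst261 σW ≤ 1∕2`
(«α₀ sufficiently small») and the budget `hB₃g : 2·AD ≤ B₃`, `hδ₃g : δ₃ ≤ ρ` (`0 ≤ ρ ≤ δPs`, `ρ + σW ≤ δK`).  GONE from the signature: `𝔭A hparB h𝔭A θ B₀' δ₀' BH θH Bh hθ hθH hB₀'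
hBh hBH hρS hq hwB hK he2 h43 hpX` (the raw-class step data and its budget).  ★★ `hletters13_of_pins_stateP_geo9Y : ∃ M13, ∀ x, M13 ≤ M → … → Identities (𝔬12 x) U →
Letters313Zc … B₃ δ₃ (bXH x U) U` — conclusion IDENTICAL to v1's.  With it the certificate's `hG0P` conjuncts (1)∕(4) have no consumer left (conjuncts (2)∕(3) = the
(3.42)₃∕(3.43)₂ words feed `…StateProducersAAtPinsPU` as before).
HONEST FRAMING.  Kernel bookkeeping (∃-packaging of three landed Literature theorems with landed member-fact theorems); every member (`hZ8`, `h44`, `h31`, `h49`, `hS`,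
`hPDs`, `hdomS`, `hI`) is a HYPOTHESIS of printed species, a state-layer output or the instance's dictionary; nothing of [B9] asserted; COUNT-NEUTRAL; N06 NOT discharged;
K1⁹ NOT closed; one finite 𝕋⁴ programme at fixed `ε` — NOT continuum ∕ OS ∕ mass gap ∕ Clay.  0 `def`, 0 `sorry`.
-/

noncomputable section

namespace Summit.QuantumFields.YangMills.BalabanUVNodes.N06Letters13LegAtPinsStatePU

open Literature.MathematicalPhysics.QuantumFieldTheory.Balaban1983to89
open Literature.MathematicalPhysics.QuantumFieldTheory.Balaban1983to89.Node00 (FBondY IBondY SiteY CfgY SiteParY SiteOpY BondParY parSymY parBY GpY GpPhysY)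
open Literature.MathematicalPhysics.QuantumFieldTheory.Balaban1983to89.Node00.OpsYSectDCoords (DvcoKH DvscoKH RcoK cR39_trBasis_pos)
open Literature.MathematicalPhysics.QuantumFieldTheory.Balaban1983to89.B9Thm39ReadingCoords (cR39)
open Literature.MathematicalPhysics.QuantumFieldTheory.Balaban1983to89.B9Thm34Ext (toB6)
open Literature.MathematicalPhysics.QuantumFieldTheory.Balaban1983to89.B11SectG (HasMaj BlockNorm RowSum)
open Literature.MathematicalPhysics.QuantumFieldTheory.Balaban1983to89.B9Thm312Whole (cNorm GeoOK)
open Literature.MathematicalPhysics.QuantumFieldTheory.Balaban1983to89.B9Thm312WholeClasses (cNormR)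
open Literature.MathematicalPhysics.QuantumFieldTheory.Balaban1983to89.B9RWSums343Holder (HolderProbes)
open Literature.MathematicalPhysics.QuantumFieldTheory.Balaban1983to89.B9RWSums343to347Whole (Facts347)
open Literature.MathematicalPhysics.QuantumFieldTheory.Balaban1983to89.B9CoReadingCoords (XBK blkBK)
open Literature.MathematicalPhysics.QuantumFieldTheory.Balaban1983to89.B9CoReadingCoordsS (XSK sIK blkSK GcoS)
open Literature.MathematicalPhysics.QuantumFieldTheory.Balaban1983to89.B9CoReadingCoordsH (XHK)
open Literature.MathematicalPhysics.QuantumFieldTheory.Balaban1983to89.B9CoReadingCoordsHolder (PK)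
open Literature.MathematicalPhysics.QuantumFieldTheory.Balaban1983to89.B9CoReadingCoordsTranspose (TrIdx trBasis)
open Literature.MathematicalPhysics.QuantumFieldTheory.Balaban1983to89.B9PinMembersKLevelV1 (MemberY geo9Y geo9Y_M)
open Literature.MathematicalPhysics.QuantumFieldTheory.Balaban1983to89.B9BackgroundsKLevelV1R (RegFamY bg9YR MemOfFam)
open Literature.MathematicalPhysics.QuantumFieldTheory.Balaban1983to89.B9GeoLemma21KLevelV1 (geo9Y_len_pos geo9Y_dist_triangle geo9Y_dist_comm)
open Literature.MathematicalPhysics.QuantumFieldTheory.Balaban1983to89.B9GeoNormsKLevelV1 (geo9K geo9K_dist_nonneg)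
open Literature.MathematicalPhysics.QuantumFieldTheory.Balaban1983to89.B7Prop2SpecialUnitary (specialUnitaryUnits)
open Literature.MathematicalPhysics.QuantumFieldTheory.Balaban1983to89.B9PerturbationMajorantAlgebra (Proj349Maj)
open Literature.MathematicalPhysics.QuantumFieldTheory.Balaban1983to89.B9PerturbationMajorantsAtLetters (PcoK rcoK_eq)
open Literature.MathematicalPhysics.QuantumFieldTheory.Balaban1983to89.B9PerturbationMajorantsAtLettersPhys (rcoK_GpPhysY)
open Literature.MathematicalPhysics.QuantumFieldTheory.Balaban1983to89.B9MultiscaleSmoothPartitionYNear (rNear)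
open Literature.MathematicalPhysics.QuantumFieldTheory.Balaban1983to89.B9SmoothHolderClassP (bHZKP bHZKPG)
open Literature.MathematicalPhysics.QuantumFieldTheory.Balaban1983to89.B9GradViaDivLettersTransported (taxiB)
open Literature.MathematicalPhysics.QuantumFieldTheory.Balaban1983to89.B9Thm313WholeCutLettersAtPinsP (wGp_bHZKPG_of_pins)
open Literature.MathematicalPhysics.QuantumFieldTheory.Balaban1983to89.B9Thm313WholeGXHRegular (gXH_of_stateS_two)
open Literature.MathematicalPhysics.QuantumFieldTheory.Balaban1983to89.B9Thm312WholeStepRegular (StepS)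
open Literature.MathematicalPhysics.QuantumFieldTheory.Balaban1983to89.B9Thm312WholeClasses (cNormR)
open Literature.MathematicalPhysics.QuantumFieldTheory.Balaban1983to89.B9RWSums347DefiniteFaces (exp261 facts347_exp261_geo9Y)
open Literature.MathematicalPhysics.QuantumFieldTheory.Balaban1983to89.B9RowSum261DefiniteFaces (rowConst261 rowConst261_nonneg rowConst261_spec_of_rowSum261)
open Literature.MathematicalPhysics.QuantumFieldTheory.Balaban1983to89.B9GeoLemma21KLevelV1 (rowSum261_geo9Y)
open Literature.MathematicalPhysics.QuantumFieldTheory.Balaban1983to89.B9SectDSup (weightNorm)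
open Literature.MathematicalPhysics.QuantumFieldTheory.Balaban1983to89.B6RandomWalkHom (HasMajorantHom)
open Literature.MathematicalPhysics.QuantumFieldTheory.Balaban1983to89.B9Thm313WholeLettersCut (Letters313Zc)
open Literature.MathematicalPhysics.QuantumFieldTheory.Balaban1983to89.B9PerturbationMajorantAlgebra (Thm31GpMaj)
open Literature.MathematicalPhysics.QuantumFieldTheory.Balaban1983to89.B9Thm312Whole (Identities)
open Literature.MathematicalPhysics.QuantumFieldTheory.Balaban1983to89.B9CoReadingCoordsHolder (blkPK probeK wK w₀K)
open Literature.MathematicalPhysics.QuantumFieldTheory.Balaban1983to89.B9CoReadingCoordsHolderAdm (wKA holderProbesKA)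
open Literature.MathematicalPhysics.QuantumFieldTheory.Balaban1983to89.B9LettersHZAtOne (plateau_pos)
open B6GlobalChartV1 (PV blkV1) open B6Ineq2142KLevelV1 (β lvl) open B6Geom246MultiLevelTorus (geomT)
open scoped Matrix.Norms.L2Operator

variable {N : ℕ} {d ℓ : ℕ} {hd : 1 ≤ d + 1} {hL : Odd (ℓ + 1) ∧ 1 < ℓ + 1} {b₀ b₁ : ℝ} {Mstar : ℕ}

/-- ★★ **`hletters13` DERIVED ABOVE A CLOSED THRESHOLD AT THE PRINT-WEIGHTED BOND PIN (P1′), `gXH` FROM THE REGULAR STATE** (module docstring): from the eight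
bXH-free letters `hZ8`, the print-literal (3.44) member `h44` for G′ (+ `h31 h49`, budget `hB₃w`, rates on the displayed `αW σW δFW`), the state layer's step `hS` on bXH,
producer `hPDs` (G₀∇\*_U INTO bXH) and ℓ¹-domination `hdomS`, the cutting cost `hκXle`, the window `hqX`, the budget `hB₃g hδ₃g` and the pin (P1′), there is a threshold
`M13` with `Identities (𝔬12 x) U → Letters313Zc … B₃ δ₃ (bXH x U) U` for every member above it (the identities are the certificate's in-proof conjunct, supplied member-wise
AFTER the threshold) — assembled field-wise from dag-n06-l's `wGp_bHZKPG_of_pins` and `gXH_of_stateS_two`; NO raw-class step. [cite: Balaban1985BackgroundPropagators, Thm 3.13 p.426 + Thm 3.12 pp.421–423 + (3.42)–(3.45) pp.397–398 + (3.49) p.399 + (3.152)–(3.153) p.426; Balaban1984PropagatorsII, (2.51)–(2.56) pp.232–233 + Lemma 2.1 (2.60)–(2.61) p.234 + (2.66) p.234] -/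
theorem hletters13_of_pins_stateP_geo9Y [NeZero N] [∀ x : MemberY d ℓ hd hL b₀ b₁ Mstar, Fintype (geo9Y x).Site]
    {R₁ R₂ : RegFamY d ℓ hd hL b₀ b₁ Mstar (Matrix (Fin N) (Fin N) ℂ)} (H : MemberY d ℓ hd hL b₀ b₁ Mstar → Prop)
    (bI : ∀ x : MemberY d ℓ hd hL b₀ b₁ Mstar, FBondY x.toKIdx → IBondY x.toKIdx)
    (hlev : ∀ (x : MemberY d ℓ hd hL b₀ b₁ Mstar) (f : FBondY x.toKIdx), lvl x.hN x.D x.hk (bI x f) = (blkV1 x.hN x.D f).1.1)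
    (hβ1 : ∀ (x : MemberY d ℓ hd hL b₀ b₁ Mstar) (f : FBondY x.toKIdx), (geomT x.D).dist (β x.hN x.D x.hk (bI x f)) (blkV1 x.hN x.D f) ≤ 1)
    (hbI0 : ∀ (x : MemberY d ℓ hd hL b₀ b₁ Mstar) (f : FBondY x.toKIdx), bI x f = bI x ⟨f.src, 0⟩)
    (c : ℝ) {M₀ a₀ : ℝ} {αW σW δFW : ℝ} (hαW0 : 0 < αW) (hαW1 : αW < 1) (hσW : 0 < σW) (hδFW : 0 < δFW)
    (wX : ℝ → ℝ) (hwX₀ : ∀ s, 0 ≤ wX s) (hwX₁ : ∀ s, wX s ≤ 1) {s : ℝ} (hs0 : 0 < s) (hs1 : s < 1) (hws : 0 < wX s)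
    (bXH : ∀ x : MemberY d ℓ hd hL b₀ b₁ Mstar, (bg9YR (Matrix (Fin N) (Fin N) ℂ) (specialUnitaryUnits (Fin N)) R₁ R₂ x).Cfg → BlockNorm (toB6 (geo9Y x) 1 (H x)) (XBK (TrIdx N) x.toKIdx → ℝ))
    (hbXH : ∀ (x : MemberY d ℓ hd hL b₀ b₁ Mstar) (U : (bg9YR (Matrix (Fin N) (Fin N) ℂ) (specialUnitaryUnits (Fin N)) R₁ R₂ x).Cfg), bXH x U =
      letI : Fintype (geo9K x.toKIdx).Site := (inferInstance : Fintype (geo9Y x).Site);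
      bHZKPG (κ := TrIdx N) x.toKIdx (trBasis N) (taxiB x.toKIdx (bg9YR (Matrix (Fin N) (Fin N) ℂ) (specialUnitaryUnits (Fin N)) R₁ R₂ x) (fun U => U) U) (R := (1 : ℝ)) (H := H x) wX hwX₀ hwX₁)
    (𝔬12 : ∀ x : MemberY d ℓ hd hL b₀ b₁ Mstar, B9Thm312Whole.Ops (geo9Y x) (bg9YR (Matrix (Fin N) (Fin N) ℂ) (specialUnitaryUnits (Fin N)) R₁ R₂ x) (XBK (TrIdx N) x.toKIdx) (XBK (TrIdx N) x.toKIdx) (XHK (TrIdx N) x.toKIdx) (XSK (TrIdx N) x.toKIdx))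
    (hblk12 : ∀ x : MemberY d ℓ hd hL b₀ b₁ Mstar, (𝔬12 x).blk = blkBK x.toKIdx (bI x))
    (hblkW12 : ∀ x : MemberY d ℓ hd hL b₀ b₁ Mstar, (𝔬12 x).blkW = blkSK x.toKIdx (sIK x.toKIdx (bI x)))
    (hDvco12 : ∀ (x : MemberY d ℓ hd hL b₀ b₁ Mstar) (U : (bg9YR (Matrix (Fin N) (Fin N) ℂ) (specialUnitaryUnits (Fin N)) R₁ R₂ x).Cfg), (𝔬12 x).Dv U = DvcoKH x.toKIdx (trBasis N) (bg9YR (Matrix (Fin N) (Fin N) ℂ) (specialUnitaryUnits (Fin N)) R₁ R₂ x) (fun U => U) U)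
    (hDvsco12 : ∀ (x : MemberY d ℓ hd hL b₀ b₁ Mstar) (U : (bg9YR (Matrix (Fin N) (Fin N) ℂ) (specialUnitaryUnits (Fin N)) R₁ R₂ x).Cfg), (𝔬12 x).Dvstar U = DvscoKH x.toKIdx (trBasis N) (bg9YR (Matrix (Fin N) (Fin N) ℂ) (specialUnitaryUnits (Fin N)) R₁ R₂ x) (fun U => U) U)
    (hRco12 : ∀ (x : MemberY d ℓ hd hL b₀ b₁ Mstar) (U : (bg9YR (Matrix (Fin N) (Fin N) ℂ) (specialUnitaryUnits (Fin N)) R₁ R₂ x).Cfg), (𝔬12 x).R U = RcoK x.toKIdx (trBasis N) (bg9YR (Matrix (Fin N) (Fin N) ℂ) (specialUnitaryUnits (Fin N)) R₁ R₂ x) (fun U => U) (parSymY x.toKIdx) (GpPhysY x.toKIdx (parSymY x.toKIdx)) U)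
    -- the EIGHT bXH-free letters of `Letters313Zc` (= `Letters313Z` minus its located `gD1 ∕ rgd1`), one displayed conjunction at `B₃ δ₃`
    {B₃ δ₃ : ℝ}
    (hZ8 : ∀ x : MemberY d ℓ hd hL b₀ b₁ Mstar, letI : Fintype (geo9K x.toKIdx).Site := (inferInstance : Fintype (geo9Y x).Site); M₀ ≤ (geo9Y x).M → ∀ α₀ : ℝ, 0 < α₀ → (geo9Y x).M * α₀ ≤ a₀ → ∀ U : (bg9YR (Matrix (Fin N) (Fin N) ℂ) (specialUnitaryUnits (Fin N)) R₁ R₂ x).Cfg, (bg9YR (Matrix (Fin N) (Fin N) ℂ) (specialUnitaryUnits (Fin N)) R₁ R₂ x).Reg335 c α₀ U →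
      (bg9YR (Matrix (Fin N) (Fin N) ℂ) (specialUnitaryUnits (Fin N)) R₁ R₂ x).Reg336 c α₀ U →
        HasMaj (cNorm 1 (H x) (𝔬12 x).blkW (fun y => (geo9Y_len_pos x y).le) 1) (cNorm 1 (H x) (𝔬12 x).blk (fun y => (geo9Y_len_pos x y).le) 2) ((𝔬12 x).G0 U ∘ₗ (𝔬12 x).Dv U) (fun a b => B₃ * Real.exp (-(δ₃ * (geo9Y x).dist a b))) ∧
        HasMaj (weightNorm (BlockNorm.ofBlocks (toB6 (geo9Y x) 1 (H x)) (𝔬12 x).blkZ) (fun y => ((((ℓ + 1 : ℕ) : ℝ) ^ (d + 1)) ^ lvl x.hN x.D x.hk y)⁻¹) (fun y => (plateau_pos x.toKIdx y).le)) (cNorm 1 (H x) (𝔬12 x).blk (fun y => (geo9Y_len_pos x y).le) 2) ((𝔬12 x).G0 U ∘ₗ (𝔬12 x).Qstar U) (fun a b => B₃ * Real.exp (-(δ₃ * (geo9Y x).dist a b))) ∧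
        HasMaj (weightNorm (BlockNorm.ofBlocks (toB6 (geo9Y x) 1 (H x)) (𝔬12 x).blkZ) (fun y => (geo9Y x).len y * (fun y => ((((ℓ + 1 : ℕ) : ℝ) ^ (d + 1)) ^ lvl x.hN x.D x.hk y)⁻¹) y) (fun y => (mul_pos (geo9Y_len_pos x y) (plateau_pos x.toKIdx y)).le)) (cNorm 1 (H x) (𝔬12 x).blk (fun y => (geo9Y_len_pos x y).le) 1) ((𝔬12 x).G0 U ∘ₗ (𝔬12 x).Qstar U) (fun a b => B₃ * Real.exp (-(δ₃ * (geo9Y x).dist a b))) ∧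
        HasMaj (cNorm 1 (H x) (𝔬12 x).blk (fun y => (geo9Y_len_pos x y).le) 0) (cNorm 1 (H x) (𝔬12 x).blkW (fun y => (geo9Y_len_pos x y).le) 1) ((𝔬12 x).R U ∘ₗ (𝔬12 x).Dvstar U ∘ₗ (𝔬12 x).G1 U ∘ₗ LinearMap.id) (fun a b => B₃ * Real.exp (-(δ₃ * (geo9Y x).dist a b))) ∧
        HasMaj (cNorm 1 (H x) (𝔬12 x).blkZ (fun y => (geo9Y_len_pos x y).le) 2) (weightNorm (BlockNorm.ofBlocks (toB6 (geo9Y x) 1 (H x)) (𝔬12 x).blkZ) (fun y => ((((ℓ + 1 : ℕ) : ℝ) ^ (d + 1)) ^ lvl x.hN x.D x.hk y)⁻¹) (fun y => (plateau_pos x.toKIdx y).le)) ((𝔬12 x).C1 U) (fun a b => B₃ * Real.exp (-(δ₃ * (geo9Y x).dist a b))) ∧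
        HasMaj (cNorm 1 (H x) (𝔬12 x).blkZ (fun y => (geo9Y_len_pos x y).le) 1) (weightNorm (BlockNorm.ofBlocks (toB6 (geo9Y x) 1 (H x)) (𝔬12 x).blkZ) (fun y => (geo9Y x).len y * (fun y => ((((ℓ + 1 : ℕ) : ℝ) ^ (d + 1)) ^ lvl x.hN x.D x.hk y)⁻¹) y) (fun y => (mul_pos (geo9Y_len_pos x y) (plateau_pos x.toKIdx y)).le)) ((𝔬12 x).C1 U) (fun a b => B₃ * Real.exp (-(δ₃ * (geo9Y x).dist a b))) ∧
        HasMaj (cNorm 1 (H x) (𝔬12 x).blk (fun y => (geo9Y_len_pos x y).le) 2) (cNorm 1 (H x) (𝔬12 x).blkZ (fun y => (geo9Y_len_pos x y).le) 2) ((𝔬12 x).Q U) (fun a b => B₃ * Real.exp (-(δ₃ * (geo9Y x).dist a b))) ∧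
        HasMaj (cNorm 1 (H x) (𝔬12 x).blk (fun y => (geo9Y_len_pos x y).le) 1) (cNorm 1 (H x) (𝔬12 x).blkZ (fun y => (geo9Y_len_pos x y).le) 1) ((𝔬12 x).Q U) (fun a b => B₃ * Real.exp (-(δ₃ * (geo9Y x).dist a b))))
    {B₀ δ₀ CP δP B44 δ44 : ℝ} (hB₀ : 0 ≤ B₀) (hCP : 0 ≤ CP) (hB44 : 0 ≤ B44)
    (hδ₀ : δFW ≤ δ₀) (hδP : δFW ≤ δP) (hbud : 0 ≤ δFW - αW * δFW - 2 * σW) (hδ44 : δFW - αW * δFW - 2 * σW ≤ δ44)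
    (hB₃w : (cR39 (trBasis N))⁻¹ * ((wX s)⁻¹ * B44 + B₀ * (CP * (((ℓ + 1 : ℕ) : ℝ))) * ((wX s)⁻¹ * ((((ℓ + 1 : ℕ) : ℝ)) * Real.exp ((δFW - αW * δFW - σW) * (rNear d ℓ + 1)))) * rowConst261 (@geo9Y d ℓ hd hL b₀ b₁ Mstar) σW * rowConst261 (@geo9Y d ℓ hd hL b₀ b₁ Mstar) σW) ≤ B₃)
    (hδ₃w : δ₃ ≤ δFW - αW * δFW - 2 * σW)
    {parS : ∀ x : MemberY d ℓ hd hL b₀ b₁ Mstar, SiteParY (Matrix (Fin N) (Fin N) ℂ) x.toKIdx} {Gp : ∀ x : MemberY d ℓ hd hL b₀ b₁ Mstar, SiteOpY (Matrix (Fin N) (Fin N) ℂ) x.toKIdx}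
    (hparS : ∀ x : MemberY d ℓ hd hL b₀ b₁ Mstar, parS x = parSymY x.toKIdx) (hGp : ∀ x : MemberY d ℓ hd hL b₀ b₁ Mstar, Gp x = GpY x.toKIdx (parSymY x.toKIdx))
    (h31 : ∀ x : MemberY d ℓ hd hL b₀ b₁ Mstar, M₀ ≤ (geo9Y x).M → ∀ α₀ : ℝ, 0 < α₀ → (geo9Y x).M * α₀ ≤ a₀ → ∀ U : (bg9YR (Matrix (Fin N) (Fin N) ℂ) (specialUnitaryUnits (Fin N)) R₁ R₂ x).Cfg, (bg9YR (Matrix (Fin N) (Fin N) ℂ) (specialUnitaryUnits (Fin N)) R₁ R₂ x).Reg335 c α₀ U →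
      Thm31GpMaj (g := geo9Y x) (blkSK x.toKIdx (sIK x.toKIdx (bI x))) (blkBK x.toKIdx (bI x))
        (GcoS x.toKIdx (trBasis N) (bg9YR (Matrix (Fin N) (Fin N) ℂ) (specialUnitaryUnits (Fin N)) R₁ R₂ x) (fun U => U) (Gp x) U)
        (DvcoKH x.toKIdx (trBasis N) (bg9YR (Matrix (Fin N) (Fin N) ℂ) (specialUnitaryUnits (Fin N)) R₁ R₂ x) (fun U => U) U) (DvscoKH x.toKIdx (trBasis N) (bg9YR (Matrix (Fin N) (Fin N) ℂ) (specialUnitaryUnits (Fin N)) R₁ R₂ x) (fun U => U) U) 1 (H x) B₀ δ₀)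
    (h49 : ∀ x : MemberY d ℓ hd hL b₀ b₁ Mstar, M₀ ≤ (geo9Y x).M → ∀ α₀ : ℝ, 0 < α₀ → (geo9Y x).M * α₀ ≤ a₀ → ∀ U : (bg9YR (Matrix (Fin N) (Fin N) ℂ) (specialUnitaryUnits (Fin N)) R₁ R₂ x).Cfg, (bg9YR (Matrix (Fin N) (Fin N) ℂ) (specialUnitaryUnits (Fin N)) R₁ R₂ x).Reg335 c α₀ U →
      Proj349Maj (g := geo9Y x) (blkSK x.toKIdx (sIK x.toKIdx (bI x))) (blkBK x.toKIdx (bI x))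
        (PcoK x.toKIdx (trBasis N) (bg9YR (Matrix (Fin N) (Fin N) ℂ) (specialUnitaryUnits (Fin N)) R₁ R₂ x) (fun U => U) (parS x) (Gp x) U)
        (DvcoKH x.toKIdx (trBasis N) (bg9YR (Matrix (Fin N) (Fin N) ℂ) (specialUnitaryUnits (Fin N)) R₁ R₂ x) (fun U => U) U) (DvscoKH x.toKIdx (trBasis N) (bg9YR (Matrix (Fin N) (Fin N) ℂ) (specialUnitaryUnits (Fin N)) R₁ R₂ x) (fun U => U) U) 1 (H x) CP δP)
    (h44 : ∀ x : MemberY d ℓ hd hL b₀ b₁ Mstar, letI : Fintype (geo9K x.toKIdx).Site := (inferInstance : Fintype (geo9Y x).Site); M₀ ≤ (geo9Y x).M → ∀ α₀ : ℝ, 0 < α₀ → (geo9Y x).M * α₀ ≤ a₀ → ∀ U : (bg9YR (Matrix (Fin N) (Fin N) ℂ) (specialUnitaryUnits (Fin N)) R₁ R₂ x).Cfg, (bg9YR (Matrix (Fin N) (Fin N) ℂ) (specialUnitaryUnits (Fin N)) R₁ R₂ x).Reg335 c α₀ U →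
      (bg9YR (Matrix (Fin N) (Fin N) ℂ) (specialUnitaryUnits (Fin N)) R₁ R₂ x).Reg336 c α₀ U →
        HasMaj (bHZKP (κ := TrIdx N) x.toKIdx (trBasis N) (taxiB x.toKIdx (bg9YR (Matrix (Fin N) (Fin N) ℂ) (specialUnitaryUnits (Fin N)) R₁ R₂ x) (fun U => U) U) (R := (1 : ℝ)) (H := H x) (s := s) hs0.le hs1.le) (cNorm 1 (H x) (𝔬12 x).blk (fun y => (geo9Y_len_pos x y).le) 1)
          ((𝔬12 x).Dv U ∘ₗ GcoS x.toKIdx (trBasis N) (bg9YR (Matrix (Fin N) (Fin N) ℂ) (specialUnitaryUnits (Fin N)) R₁ R₂ x) (fun U => U) (GpY x.toKIdx (parSymY x.toKIdx)) U ∘ₗ (𝔬12 x).Dvstar U) (fun a b => B44 * Real.exp (-(δ44 * (geo9Y x).dist a b))))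
    -- the `gXH` data FROM THE REGULAR STATE 𝔖₁ = bXH (P-U8S″, dag-n06-l `B9Thm313WholeGXHRegular.gXH_of_stateS_two`): the (3.130)∕(3.138) step ON bXH, Theorem 3.3's
    -- producer G₀∇\*_U INTO bXH, the ℓ¹-domination of bXH, its cutting cost, the «α₀ sufficiently small» window and the budget — NO step on a raw sup class
    {θS δK AD δPs ρ κX : ℝ} (hθS : 0 ≤ θS) (hAD : 0 ≤ AD) (hρ : 0 ≤ ρ) (hρP : ρ ≤ δPs) (hρδ : ρ + σW ≤ δK)
    (hκXle : ∀ (x : MemberY d ℓ hd hL b₀ b₁ Mstar) (U : (bg9YR (Matrix (Fin N) (Fin N) ℂ) (specialUnitaryUnits (Fin N)) R₁ R₂ x).Cfg), (bXH x U).κ ≤ κX)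
    (hqX : κX * (θS * a₀) * rowConst261 (@geo9Y d ℓ hd hL b₀ b₁ Mstar) σW ≤ 1 / 2)
    (hS : ∀ x : MemberY d ℓ hd hL b₀ b₁ Mstar, M₀ ≤ (geo9Y x).M → ∀ α₀ : ℝ, 0 < α₀ → (geo9Y x).M * α₀ ≤ a₀ → ∀ U : (bg9YR (Matrix (Fin N) (Fin N) ℂ) (specialUnitaryUnits (Fin N)) R₁ R₂ x).Cfg, (bg9YR (Matrix (Fin N) (Fin N) ℂ) (specialUnitaryUnits (Fin N)) R₁ R₂ x).Reg335 c α₀ U →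
      (bg9YR (Matrix (Fin N) (Fin N) ℂ) (specialUnitaryUnits (Fin N)) R₁ R₂ x).Reg336 c α₀ U → StepS (𝔬12 x) (bXH x U) (θS * ((geo9Y x).M * α₀)) δK U)
    (hPDs : ∀ x : MemberY d ℓ hd hL b₀ b₁ Mstar, M₀ ≤ (geo9Y x).M → ∀ α₀ : ℝ, 0 < α₀ → (geo9Y x).M * α₀ ≤ a₀ → ∀ U : (bg9YR (Matrix (Fin N) (Fin N) ℂ) (specialUnitaryUnits (Fin N)) R₁ R₂ x).Cfg, (bg9YR (Matrix (Fin N) (Fin N) ℂ) (specialUnitaryUnits (Fin N)) R₁ R₂ x).Reg335 c α₀ U →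
      (bg9YR (Matrix (Fin N) (Fin N) ℂ) (specialUnitaryUnits (Fin N)) R₁ R₂ x).Reg336 c α₀ U →
        HasMaj (cNormR 1 (H x) (𝔬12 x).blkY (fun y => (geo9Y_len_pos x y).le) 0) (bXH x U) ((𝔬12 x).G0 U ∘ₗ (𝔬12 x).Dstar U) (fun a b => AD * Real.exp (-(δPs * (geo9Y x).dist a b))))
    (hdomS : ∀ x : MemberY d ℓ hd hL b₀ b₁ Mstar, M₀ ≤ (geo9Y x).M → ∀ α₀ : ℝ, 0 < α₀ → (geo9Y x).M * α₀ ≤ a₀ → ∀ U : (bg9YR (Matrix (Fin N) (Fin N) ℂ) (specialUnitaryUnits (Fin N)) R₁ R₂ x).Cfg, (bg9YR (Matrix (Fin N) (Fin N) ℂ) (specialUnitaryUnits (Fin N)) R₁ R₂ x).Reg335 c α₀ U →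
      (bg9YR (Matrix (Fin N) (Fin N) ℂ) (specialUnitaryUnits (Fin N)) R₁ R₂ x).Reg336 c α₀ U →
        ∃ Λ : ℝ, 0 ≤ Λ ∧ ∀ (y : (geo9Y x).Site) (F : XBK (TrIdx N) x.toKIdx → ℝ), (bXH x U).loc y F ≤ Λ * ∑ q : XBK (TrIdx N) x.toKIdx, |F q|)
    (hB₃g : 2 * AD ≤ B₃) (hδ₃g : δ₃ ≤ ρ) :
    ∃ M13 : ℝ, ∀ x : MemberY d ℓ hd hL b₀ b₁ Mstar, letI : Fintype (geo9K x.toKIdx).Site := (inferInstance : Fintype (geo9Y x).Site); M13 ≤ (geo9Y x).M → ∀ α₀ : ℝ, 0 < α₀ → (geo9Y x).M * α₀ ≤ a₀ → ∀ U : (bg9YR (Matrix (Fin N) (Fin N) ℂ) (specialUnitaryUnits (Fin N)) R₁ R₂ x).Cfg, (bg9YR (Matrix (Fin N) (Fin N) ℂ) (specialUnitaryUnits (Fin N)) R₁ R₂ x).Reg335 c α₀ U →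
      (bg9YR (Matrix (Fin N) (Fin N) ℂ) (specialUnitaryUnits (Fin N)) R₁ R₂ x).Reg336 c α₀ U → Identities (𝔬12 x) U →
        Letters313Zc (𝔬12 x) (fun U => GcoS x.toKIdx (trBasis N) (bg9YR (Matrix (Fin N) (Fin N) ℂ) (specialUnitaryUnits (Fin N)) R₁ R₂ x) (fun U => U) (GpY x.toKIdx (parSymY x.toKIdx)) U) 1 (H x) ⟨geo9Y_dist_triangle x, geo9Y_dist_comm x, geo9K_dist_nonneg x.toKIdx, geo9Y_len_pos x⟩ (fun y => ((((ℓ + 1 : ℕ) : ℝ) ^ (d + 1)) ^ lvl x.hN x.D x.hk y)⁻¹) (fun y => plateau_pos x.toKIdx y) B₃ δ₃ (bXH x U) U := by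
  obtain ⟨Mg, hFa⟩ := facts347_exp261_geo9Y (d := d) (ℓ := ℓ) (hd := hd) (hL := hL) (b₀ := b₀) (b₁ := b₁) (Mstar := Mstar) H hαW0 hαW1 hδFW
  obtain ⟨ML, hrow⟩ := rowConst261_spec_of_rowSum261 (rowSum261_geo9Y (d := d) (ℓ := ℓ) (hd := hd) (hL := hL) (b₀ := b₀) (b₁ := b₁) (Mstar := Mstar)) hσW
  have hc0 : (0 : ℝ) ≤ rowConst261 (@geo9Y d ℓ hd hL b₀ b₁ Mstar) σW := rowConst261_nonneg _ _
  have hαδ : 0 ≤ αW * δFW := (mul_pos hαW0 hδFW).le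
  refine ⟨max M₀ (max Mg ML), fun x hM α₀ hα ha U hU hU' hIx => ?_⟩
  letI : Fintype (geo9K x.toKIdx).Site := (inferInstance : Fintype (geo9Y x).Site)
  have hM0 : M₀ ≤ (geo9Y x).M := (le_max_left _ _).trans hM
  have hrowx : RowSum (toB6 (geo9Y x) 1 (H x)) σW (rowConst261 (@geo9Y d ℓ hd hL b₀ b₁ Mstar) σW) := fun y => hrow x (((le_max_right _ _).trans (le_max_right _ _)).trans hM) y
  have hFax := hFa x (((le_max_left _ _).trans (le_max_right _ _)).trans hM)
  have hG : GeoOK (geo9Y x) := ⟨geo9Y_dist_triangle x, geo9Y_dist_comm x, geo9K_dist_nonneg x.toKIdx, geo9Y_len_pos x⟩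
  have hN : 0 < N := Nat.pos_of_ne_zero (NeZero.ne N)
  have hϱ : 0 ≤ (cR39 (trBasis N))⁻¹ := inv_nonneg.2 (cR39_trBasis_pos hN).le
  have hR : (𝔬12 x).R U = (cR39 (trBasis N))⁻¹ • (LinearMap.id -
      PcoK x.toKIdx (trBasis N) (bg9YR (Matrix (Fin N) (Fin N) ℂ) (specialUnitaryUnits (Fin N)) R₁ R₂ x) (fun U => U) (parSymY x.toKIdx) (GpY x.toKIdx (parSymY x.toKIdx)) U) := by
    rw [hRco12 x U, rcoK_GpPhysY, rcoK_eq]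
  have h49' : Proj349Maj (𝔬12 x).blkW (𝔬12 x).blk
      (PcoK x.toKIdx (trBasis N) (bg9YR (Matrix (Fin N) (Fin N) ℂ) (specialUnitaryUnits (Fin N)) R₁ R₂ x) (fun U => U) (parSymY x.toKIdx) (GpY x.toKIdx (parSymY x.toKIdx)) U)
      ((𝔬12 x).Dv U) ((𝔬12 x).Dvstar U) 1 (H x) CP δP := by
    rw [hblkW12 x, hblk12 x, hDvco12 x U, hDvsco12 x U, ← hGp x, ← hparS x]
    exact h49 x hM0 α₀ hα ha U hU
  have h31' : Thm31GpMaj (𝔬12 x).blkW (𝔬12 x).blk (GcoS x.toKIdx (trBasis N) (bg9YR (Matrix (Fin N) (Fin N) ℂ) (specialUnitaryUnits (Fin N)) R₁ R₂ x) (fun U => U) (GpY x.toKIdx (parSymY x.toKIdx)) U) ((𝔬12 x).Dv U) ((𝔬12 x).Dvstar U) 1 (H x) B₀ δ₀ := by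
    rw [hblkW12 x, hblk12 x, hDvco12 x U, hDvsco12 x U, ← hGp x]
    exact h31 x hM0 α₀ hα ha U hU
  have z := hZ8 x hM0 α₀ hα ha U hU hU'
  refine ⟨z.1, z.2.1, z.2.2.1, z.2.2.2.1, z.2.2.2.2.1, z.2.2.2.2.2.1, z.2.2.2.2.2.2.1, z.2.2.2.2.2.2.2, ?_, ?_⟩
  · -- `gXH` FROM THE STATE: G₁∇\*_U INTO bXH by the right-entry bootstrap on 𝔖₁ = bXH (no raw-class step)
    obtain ⟨Λ, hΛ, hdom⟩ := hdomS x hM0 α₀ hα ha U hU hU'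
    have hMa0 : 0 ≤ (geo9Y x).M * α₀ := mul_nonneg (by rw [geo9Y_M]; positivity) hα.le
    have hθ0 : 0 ≤ θS * ((geo9Y x).M * α₀) := mul_nonneg hθS hMa0
    have hq' : (bXH x U).κ * (θS * ((geo9Y x).M * α₀)) * rowConst261 (@geo9Y d ℓ hd hL b₀ b₁ Mstar) σW ≤ 1 / 2 := by
      have h1 : (bXH x U).κ * (θS * ((geo9Y x).M * α₀)) ≤ κX * (θS * a₀) :=
        mul_le_mul (hκXle x U) (mul_le_mul_of_nonneg_left ha hθS) hθ0 ((bXH x U).κ_nonneg.trans (hκXle x U))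
      exact (mul_le_mul_of_nonneg_right h1 hc0).trans hqX
    have h := gXH_of_stateS_two hG hrowx hθ0 hAD hρ hρP hρδ (hS x hM0 α₀ hα ha U hU hU') (hPDs x hM0 α₀ hα ha U hU hU') hIx hΛ hdom hq'
    refine h.mono fun a b => ?_
    have hd : 0 ≤ (geo9Y x).dist a b := geo9K_dist_nonneg x.toKIdx a b
    calc 2 * AD * Real.exp (-(ρ * (geo9Y x).dist a b)) ≤ 2 * AD * Real.exp (-(δ₃ * (geo9Y x).dist a b)) :=
          mul_le_mul_of_nonneg_left (Real.exp_le_exp.mpr (neg_le_neg (mul_le_mul_of_nonneg_right hδ₃g hd))) (by linarith)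
      _ ≤ B₃ * Real.exp (-(δ₃ * (geo9Y x).dist a b)) := mul_le_mul_of_nonneg_right hB₃g (Real.exp_nonneg _)
  · have h := wGp_bHZKPG_of_pins x.toKIdx (trBasis N) (taxiB x.toKIdx (bg9YR (Matrix (Fin N) (Fin N) ℂ) (specialUnitaryUnits (Fin N)) R₁ R₂ x) (fun U => U) U) hG hFax hrowx
      (Gp := fun U => GcoS x.toKIdx (trBasis N) (bg9YR (Matrix (Fin N) (Fin N) ℂ) (specialUnitaryUnits (Fin N)) R₁ R₂ x) (fun U => U) (GpY x.toKIdx (parSymY x.toKIdx)) U)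
      (P := PcoK x.toKIdx (trBasis N) (bg9YR (Matrix (Fin N) (Fin N) ℂ) (specialUnitaryUnits (Fin N)) R₁ R₂ x) (fun U => U) (parSymY x.toKIdx) (GpY x.toKIdx (parSymY x.toKIdx)))
      wX hwX₀ hwX₁ hs0 hs1 hws (hβ1 x) (hlev x) (hbI0 x) x.hcfk (hblk12 x) h31' h49' hR (h44 x hM0 α₀ hα ha U hU hU')
      hϱ hB₀ hCP hB44 hc0 hσW.le hαδ hδ₀ hδP hbud hδ44 hB₃w hδ₃w
    rw [hbXH x U]
    exact h

end Summit.QuantumFields.YangMills.BalabanUVNodes.N06Letters13LegAtPinsStatePU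

end
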